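import Mathlib
import Summits.NavierStokesRegularity.NavierStokesRegularity.Theorems.ZoomReturnDoorDefs

/-!
# ZoomReturnDoorLimit — S25 «ZoomReturnDoor», part 6/6 (prover material for K-band/K-open), ROUND-24 §3 steps B2–B3 (the step NOT in Chae–Wolf): SMALL ECHOES PASS TO THE
# LIMIT AS EXACT ONE-FACTOR SYMMETRY

Setting of the K-band plan: profiles `vₙ` with `(κₙ, √κₙ)`-echo defects `≤ εₙ` on a window `U`, `κₙ → κ ∈ (0,1)`,
`εₙ → 0`, and `vₙ → v` by CONTINUOUS CONVERGENCE below a time `t₁` (what the Chae–Wolf equi-Lipschitz extraction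
delivers).  PROVED here, abstractly (no PDE):
* `tendsto_profileDefect` — the defects converge pointwise; `lintegral_profileDefect_eq_zero` — FATOU: the limit has
  ZERO integrated defect on `U` at every admissible profile time; `windowIdentity_of_lintegral_eq_zero` — with continuous
  slices and `U` open the defect vanishes pointwise on `U` (exact window identity);
* `twoPoint_of_window` — ANALYTIC SPREAD at a fixed time: analytic slices + window identity on an open nonempty `U` ⇒
  `v(s, z) = μ · v(κ s, μ z)` for all `z`;
* `oneFactor_of_pastTwoPoint` — the past two-point symmetry at ratio `(κ, √κ)` for `s ≤ s₁` IS the one-factor symmetry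
  `v(t, w) = c · v(c² t, c w)`, `c = 1/√κ > 1`, for `t ≤ κ s₁` — exactly the hypothesis `hsym` of `ZoomReturnDoorDssExtension.exists_dss_extension`;
* package `oneFactor_of_smallEcho_limit`; and for the K-open plan `oneFactor_of_dss_limit` (G3: exact `cₙ`-DSS passes to
  the limit as exact `c`-symmetry, `c = lim cₙ`).
Composition with `ZoomReturnDoorDssExtension` (part 5/6, G4 algebraic half): the limit extends to a global `(1/√κ)`-DSS field with the Type-I decay,
so `RemovableFactor D (1/√κ)` kills it — the K-band contradiction.  nsreg-p1 g20 (ADDENDUM-24B; design file `r24/Sketch25lim.lean`); THEOREMS-ONLY, no route, no items; `profileDefect` /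
`HasSmallEchoOn` are the kit's (`ZoomReturnDoorDefs`, part 1/6).
-/

noncomputable section

set_option linter.dupNamespace false
set_option linter.unusedVariables false

namespace Summit.NavierStokesRegularity.NavierStokesRegularity.Theorems.ZoomReturnDoorLimit

open MeasureTheory Set Function Filter Topology Metric
open scoped ENNReal NNReal Topology
open Summit.NavierStokesRegularity.NavierStokesRegularity.Theorems.ZoomReturnDoorDefs

section Limit

variable {ν : ℝ} {vn : ℕ → ℝ → EuclideanSpace ℝ (Fin 3) → EuclideanSpace ℝ (Fin 3)} {v : ℝ → EuclideanSpace ℝ (Fin 3) → EuclideanSpace ℝ (Fin 3)} {κn εn : ℕ → ℝ} {κ t₁ : ℝ}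

/-- **B2 (pointwise).**  Under continuous convergence below `t₁` and `κₙ → κ`, the `(κₙ, √κₙ)`-defects of `vₙ` converge
to the `(κ, √κ)`-defect of `v` at every point, for profile times `s` with `s, κ s < t₁`. -/
theorem tendsto_profileDefect (hκn : Tendsto κn atTop (𝓝 κ))
    (hcc : ∀ t < t₁, ∀ (x : EuclideanSpace ℝ (Fin 3)) (tn : ℕ → ℝ) (xn : ℕ → EuclideanSpace ℝ (Fin 3)), Tendsto tn atTop (𝓝 t) →
      Tendsto xn atTop (𝓝 x) → Tendsto (fun n => vn n (tn n) (xn n)) atTop (𝓝 (v t x)))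
    {s : ℝ} (hs₁ : s < t₁) (hκs₁ : κ * s < t₁) (y : EuclideanSpace ℝ (Fin 3)) :
    Tendsto (fun n => profileDefect ν (vn n) (κn n) (Real.sqrt (κn n)) s y) atTop
      (𝓝 (profileDefect ν v κ (Real.sqrt κ) s y)) := by
  set σ : ℝ := Real.sqrt (-s) / Real.sqrt ν with hσ
  have h1 : Tendsto (fun n => vn n s (σ • y)) atTop (𝓝 (v s (σ • y))) :=
    hcc s hs₁ (σ • y) (fun _ => s) (fun _ => σ • y) tendsto_const_nhds tendsto_const_nhds
  have hsc : Tendsto (fun n => Real.sqrt (κn n) * σ) atTop (𝓝 (Real.sqrt κ * σ)) :=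
    hκn.sqrt.mul_const σ
  have h2 : Tendsto (fun n => vn n (κn n * s) ((Real.sqrt (κn n) * σ) • y)) atTop
      (𝓝 (v (κ * s) ((Real.sqrt κ * σ) • y))) :=
    hcc (κ * s) hκs₁ _ (fun n => κn n * s) (fun n => (Real.sqrt (κn n) * σ) • y) (hκn.mul_const s)
      (hsc.smul_const y)
  have hsc' : Tendsto (fun n => Real.sqrt (κn n) * σ * ν) atTop (𝓝 (Real.sqrt κ * σ * ν)) :=
    hsc.mul_const ν
  have h := ((h1.const_smul (σ * ν)).sub (hsc'.smul h2)).norm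
  simpa only [profileDefect, hσ] using h

/-- **B3 (Fatou).**  If moreover every `vₙ` has `(κₙ, √κₙ)`-echo defect `≤ εₙ` on `U` with `εₙ → 0`, `0 < κₙ`, and the
slices of `vₙ` at negative times are continuous, then the limit has ZERO integrated defect on `U` at every profile time
`s < 0` with `s, κ s < t₁`. -/
theorem lintegral_profileDefect_eq_zero (hκn : Tendsto κn atTop (𝓝 κ)) (hκn0 : ∀ n, 0 < κn n)
    (hεn : Tendsto εn atTop (𝓝 0)) (hslice : ∀ n, ∀ t < 0, Continuous (vn n t))
    (hcc : ∀ t < t₁, ∀ (x : EuclideanSpace ℝ (Fin 3)) (tn : ℕ → ℝ) (xn : ℕ → EuclideanSpace ℝ (Fin 3)), Tendsto tn atTop (𝓝 t) →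
      Tendsto xn atTop (𝓝 x) → Tendsto (fun n => vn n (tn n) (xn n)) atTop (𝓝 (v t x)))
    {U : Set (EuclideanSpace ℝ (Fin 3))} (hecho : ∀ n, HasSmallEchoOn ν (κn n) (Real.sqrt (κn n)) (εn n) U (vn n))
    {s : ℝ} (hs : s < 0) (hs₁ : s < t₁) (hκs₁ : κ * s < t₁) :
    ∫⁻ y in U, ENNReal.ofReal (profileDefect ν v κ (Real.sqrt κ) s y) = 0 := by
  set σ : ℝ := Real.sqrt (-s) / Real.sqrt ν with hσ
  set F : ℕ → EuclideanSpace ℝ (Fin 3) → ℝ≥0∞ := fun n y => ENNReal.ofReal (profileDefect ν (vn n) (κn n) (Real.sqrt (κn n)) s y)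
    with hF
  -- measurability of each `Fₙ` (continuity of the two slices involved)
  have hFc : ∀ n, Continuous fun y => profileDefect ν (vn n) (κn n) (Real.sqrt (κn n)) s y := by
    intro n
    have hκs : κn n * s < 0 := mul_neg_of_pos_of_neg (hκn0 n) hs
    have c1 : Continuous fun y : EuclideanSpace ℝ (Fin 3) => (σ * ν) • vn n s (σ • y) :=
      ((hslice n s hs).comp (continuous_const_smul σ)).const_smul (σ * ν)
    have c2 : Continuous fun y : EuclideanSpace ℝ (Fin 3) =>
        (Real.sqrt (κn n) * σ * ν) • vn n (κn n * s) ((Real.sqrt (κn n) * σ) • y) :=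
      ((hslice n _ hκs).comp (continuous_const_smul (Real.sqrt (κn n) * σ))).const_smul
        (Real.sqrt (κn n) * σ * ν)
    have c3 : Continuous fun y : EuclideanSpace ℝ (Fin 3) => ‖(σ * ν) • vn n s (σ • y) -
        (Real.sqrt (κn n) * σ * ν) • vn n (κn n * s) ((Real.sqrt (κn n) * σ) • y)‖ := (c1.sub c2).norm
    simpa only [profileDefect, hσ] using c3
  have hFm : ∀ n, Measurable (F n) := fun n => (ENNReal.continuous_ofReal.comp (hFc n)).measurable
  have hptw : ∀ y, Tendsto (fun n => F n y) atTop
      (𝓝 (ENNReal.ofReal (profileDefect ν v κ (Real.sqrt κ) s y))) :=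
    fun y => ENNReal.tendsto_ofReal (tendsto_profileDefect hκn hcc hs₁ hκs₁ y)
  have hFatou : ∫⁻ y in U, liminf (fun n => F n y) atTop ≤ liminf (fun n => ∫⁻ y in U, F n y) atTop :=
    lintegral_liminf_le' fun n => (hFm n).aemeasurable
  have hlim : (fun y => liminf (fun n => F n y) atTop) =
      fun y => ENNReal.ofReal (profileDefect ν v κ (Real.sqrt κ) s y) :=
    funext fun y => (hptw y).liminf_eq
  rw [hlim] at hFatou
  have hbound : ∀ n, ∫⁻ y in U, F n y ≤ ENNReal.ofReal (εn n) := fun n => hecho n s hs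
  have hlimle : liminf (fun n => ∫⁻ y in U, F n y) atTop ≤ liminf (fun n => ENNReal.ofReal (εn n)) atTop :=
    liminf_le_liminf (Eventually.of_forall hbound)
  have hε0 : liminf (fun n => ENNReal.ofReal (εn n)) atTop = 0 := by
    rw [(ENNReal.tendsto_ofReal hεn).liminf_eq, ENNReal.ofReal_zero]
  exact le_antisymm ((hFatou.trans hlimle).trans hε0.le) bot_le

end Limit

section Spread

variable {ν : ℝ} {v : ℝ → EuclideanSpace ℝ (Fin 3) → EuclideanSpace ℝ (Fin 3)}

/-- **Exact window identity** from zero integrated defect (continuous slices, `U` open). -/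
theorem windowIdentity_of_lintegral_eq_zero {κ μ s : ℝ} (hs : s < 0) (hκs : κ * s < 0)
    (hvs : Continuous (v s)) (hvκ : Continuous (v (κ * s))) {U : Set (EuclideanSpace ℝ (Fin 3))} (hU : IsOpen U)
    (hint : ∫⁻ y in U, ENNReal.ofReal (profileDefect ν v κ μ s y) = 0) :
    ∀ y ∈ U, profileDefect ν v κ μ s y = 0 := by
  set σ : ℝ := Real.sqrt (-s) / Real.sqrt ν with hσ
  have hgc : Continuous fun y => profileDefect ν v κ μ s y := by
    have c1 : Continuous fun y : EuclideanSpace ℝ (Fin 3) => (σ * ν) • v s (σ • y) :=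
      (hvs.comp (continuous_const_smul σ)).const_smul (σ * ν)
    have c2 : Continuous fun y : EuclideanSpace ℝ (Fin 3) => (μ * σ * ν) • v (κ * s) ((μ * σ) • y) :=
      (hvκ.comp (continuous_const_smul (μ * σ))).const_smul (μ * σ * ν)
    have c3 : Continuous fun y : EuclideanSpace ℝ (Fin 3) => ‖(σ * ν) • v s (σ • y) - (μ * σ * ν) • v (κ * s) ((μ * σ) • y)‖ :=
      (c1.sub c2).norm
    simpa only [profileDefect, hσ] using c3
  have hgm : Measurable fun y => ENNReal.ofReal (profileDefect ν v κ μ s y) :=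
    (ENNReal.continuous_ofReal.comp hgc).measurable
  have hae : (fun y => ENNReal.ofReal (profileDefect ν v κ μ s y)) =ᵐ[volume.restrict U] 0 :=
    (lintegral_eq_zero_iff hgm).1 hint
  have heq : EqOn (fun y => ENNReal.ofReal (profileDefect ν v κ μ s y)) 0 U :=
    Measure.eqOn_open_of_ae_eq hae hU (ENNReal.continuous_ofReal.comp hgc).continuousOn continuousOn_const
  intro y hy
  have h := heq hy
  simp only [Pi.zero_apply, ENNReal.ofReal_eq_zero] at h
  exact le_antisymm h (norm_nonneg _)

/-- **ANALYTIC SPREAD at a fixed time.**  Analytic slices `v(s,·)`, `v(κ s,·)` and the exact window identity on an open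
nonempty `U` give the two-point symmetry `v(s, z) = μ · v(κ s, μ z)` for ALL `z`. -/
theorem twoPoint_of_window (hν : 0 < ν) {κ μ s : ℝ} (hs : s < 0) (hμ : 0 < μ)
    (han1 : AnalyticOnNhd ℝ (v s) univ) (han2 : AnalyticOnNhd ℝ (v (κ * s)) univ)
    {U : Set (EuclideanSpace ℝ (Fin 3))} (hU : IsOpen U) (hUne : U.Nonempty) (hwin : ∀ y ∈ U, profileDefect ν v κ μ s y = 0) :
    ∀ z, v s z = μ • v (κ * s) (μ • z) := by
  have hns : 0 < -s := neg_pos.2 hs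
  set σ : ℝ := Real.sqrt (-s) / Real.sqrt ν with hσ
  have hσpos : 0 < σ := div_pos (Real.sqrt_pos.2 hns) (Real.sqrt_pos.2 hν)
  have hσν : σ * ν ≠ 0 := mul_ne_zero hσpos.ne' hν.ne'
  set f : EuclideanSpace ℝ (Fin 3) → EuclideanSpace ℝ (Fin 3) := fun w => (σ * ν) • v s (σ • w) - (μ * σ * ν) • v (κ * s) ((μ * σ) • w) with hf
  -- `f` is real-analytic on `ℝ³`
  have hlin : ∀ a : ℝ, AnalyticOnNhd ℝ (fun w : EuclideanSpace ℝ (Fin 3) => a • w) univ := fun a w _ =>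
    analyticAt_id.const_smul (c := a)
  have hA1 : AnalyticOnNhd ℝ (fun w : EuclideanSpace ℝ (Fin 3) => v s (σ • w)) univ :=
    han1.comp (hlin σ) fun _ _ => mem_univ _
  have hA2 : AnalyticOnNhd ℝ (fun w : EuclideanSpace ℝ (Fin 3) => v (κ * s) ((μ * σ) • w)) univ :=
    han2.comp (hlin (μ * σ)) fun _ _ => mem_univ _
  have hfan : AnalyticOnNhd ℝ f univ := by
    have h1 : AnalyticOnNhd ℝ (fun w : EuclideanSpace ℝ (Fin 3) => (σ * ν) • v s (σ • w)) univ := fun w hw =>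
      (hA1 w hw).const_smul (c := σ * ν)
    have h2 : AnalyticOnNhd ℝ (fun w : EuclideanSpace ℝ (Fin 3) => (μ * σ * ν) • v (κ * s) ((μ * σ) • w)) univ := fun w hw =>
      (hA2 w hw).const_smul (c := μ * σ * ν)
    exact h1.sub h2
  -- `f = 0` on the window, hence near a window point, hence everywhere
  have hfU : ∀ y ∈ U, f y = 0 := by
    intro y hy
    have h := hwin y hy
    simp only [profileDefect] at h
    exact norm_eq_zero.1 h
  obtain ⟨y₀, hy₀⟩ := hUne
  have hev : f =ᶠ[𝓝 y₀] 0 := by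
    filter_upwards [hU.mem_nhds hy₀] with y hy
    exact hfU y hy
  have hzero : EqOn f 0 univ :=
    hfan.eqOn_zero_of_preconnected_of_eventuallyEq_zero isPreconnected_univ (mem_univ y₀) hev
  intro z
  have h := hzero (mem_univ (σ⁻¹ • z))
  simp only [hf, Pi.zero_apply, smul_smul] at h
  rw [mul_assoc μ σ σ⁻¹, mul_inv_cancel₀ hσpos.ne', mul_one, one_smul] at h
  have h1 : (σ * ν) • v s z = (σ * ν) • (μ • v (κ * s) (μ • z)) := by
    rw [smul_smul, show σ * ν * μ = μ * σ * ν by ring]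
    exact sub_eq_zero.1 h
  exact smul_right_injective (EuclideanSpace ℝ (Fin 3)) hσν h1

/-- **The past two-point symmetry at ratio `(κ, √κ)` IS a one-factor symmetry with factor `c = 1/√κ`.**  If
`v(s, z) = √κ · v(κ s, √κ z)` for all `s ≤ s₁` and all `z`, then `v(t, w) = c · v(c² t, c w)` for all `t ≤ κ s₁` —
the hypothesis `hsym` of `ZoomReturnDoorDssExtension.exists_dss_extension` with `t₀ = κ s₁`. -/
theorem oneFactor_of_pastTwoPoint {κ s₁ : ℝ} (hκ : 0 < κ)
    (htwo : ∀ s ≤ s₁, ∀ z, v s z = (Real.sqrt κ) • v (κ * s) ((Real.sqrt κ) • z)) :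
    ∀ t ≤ κ * s₁, ∀ w, v t w = (Real.sqrt κ)⁻¹ • v ((Real.sqrt κ)⁻¹ ^ 2 * t) ((Real.sqrt κ)⁻¹ • w) := by
  intro t ht w
  have hr : 0 < Real.sqrt κ := Real.sqrt_pos.2 hκ
  have hc2 : (Real.sqrt κ)⁻¹ ^ 2 = κ⁻¹ := by rw [inv_pow, Real.sq_sqrt hκ.le]
  have hst : κ⁻¹ * t ≤ s₁ := by
    rw [inv_mul_le_iff₀ hκ]; exact ht
  have h := htwo (κ⁻¹ * t) hst ((Real.sqrt κ)⁻¹ • w)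
  rw [← mul_assoc, mul_inv_cancel₀ hκ.ne', one_mul, smul_smul, mul_inv_cancel₀ hr.ne', one_smul] at h
  rw [hc2, h, smul_smul, inv_mul_cancel₀ hr.ne', one_smul]

end Spread

/-- **B2–B3 PACKAGED: small echoes pass to the limit as exact one-factor symmetry.**  Profiles `vₙ` (continuous negative
slices) with `(κₙ, √κₙ)`-echo defects `≤ εₙ` on an open nonempty window `U`, `0 < κₙ → κ > 0`, `εₙ → 0`, converging
continuously to `v` below the time `t₁`, where `v` has real-analytic slices below `t₁`: then for every `s₁ < 0` with
`s₁ < t₁` and `κ s₁ < t₁`, the limit has the one-factor symmetry `v(t, w) = c · v(c² t, c w)`, `c = 1/√κ`, for all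
`t ≤ κ s₁` — feed this (with the decay on `t ≤ κ s₁`) to `ZoomReturnDoorDssExtension.exists_dss_extension`. -/
theorem oneFactor_of_smallEcho_limit {ν : ℝ} (hν : 0 < ν) {vn : ℕ → ℝ → EuclideanSpace ℝ (Fin 3) → EuclideanSpace ℝ (Fin 3)} {v : ℝ → EuclideanSpace ℝ (Fin 3) → EuclideanSpace ℝ (Fin 3)}
    {κn εn : ℕ → ℝ} {κ t₁ s₁ : ℝ} (hκ : 0 < κ) (hκn : Tendsto κn atTop (𝓝 κ)) (hκn0 : ∀ n, 0 < κn n)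
    (hεn : Tendsto εn atTop (𝓝 0)) (hslice : ∀ n, ∀ t < 0, Continuous (vn n t))
    (hcc : ∀ t < t₁, ∀ (x : EuclideanSpace ℝ (Fin 3)) (tn : ℕ → ℝ) (xn : ℕ → EuclideanSpace ℝ (Fin 3)), Tendsto tn atTop (𝓝 t) →
      Tendsto xn atTop (𝓝 x) → Tendsto (fun n => vn n (tn n) (xn n)) atTop (𝓝 (v t x)))
    (han : ∀ t < t₁, t < 0 → AnalyticOnNhd ℝ (v t) univ)
    {U : Set (EuclideanSpace ℝ (Fin 3))} (hU : IsOpen U) (hUne : U.Nonempty)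
    (hecho : ∀ n, HasSmallEchoOn ν (κn n) (Real.sqrt (κn n)) (εn n) U (vn n))
    (hs₁ : s₁ < 0) (hs₁t : s₁ < t₁) (hκs₁t : κ * s₁ < t₁) :
    ∀ t ≤ κ * s₁, ∀ w, v t w = (Real.sqrt κ)⁻¹ • v ((Real.sqrt κ)⁻¹ ^ 2 * t) ((Real.sqrt κ)⁻¹ • w) := by
  refine oneFactor_of_pastTwoPoint hκ fun s hs z => ?_
  have hs0 : s < 0 := lt_of_le_of_lt hs hs₁
  have hst : s < t₁ := lt_of_le_of_lt hs hs₁t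
  have hκs0 : κ * s < 0 := mul_neg_of_pos_of_neg hκ hs0
  have hκst : κ * s < t₁ := by nlinarith
  have han1 : AnalyticOnNhd ℝ (v s) univ := han s hst hs0
  have han2 : AnalyticOnNhd ℝ (v (κ * s)) univ := han (κ * s) hκst hκs0
  have hint := lintegral_profileDefect_eq_zero hκn hκn0 hεn hslice hcc hecho hs0 hst hκst
  have hvs : Continuous (v s) := by
    rw [← continuousOn_univ]; exact han1.continuousOn
  have hvκ : Continuous (v (κ * s)) := by
    rw [← continuousOn_univ]; exact han2.continuousOn
  have hwin := windowIdentity_of_lintegral_eq_zero hs0 hκs0 hvs hvκ hU hint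
  exact twoPoint_of_window hν hs0 (Real.sqrt_pos.2 hκ) han1 han2 hU hUne hwin z

/-- **G3 (K-open plan): exact `cₙ`-DSS passes to a continuous-convergence limit as the exact one-factor symmetry
with the limit factor `c = lim cₙ ≥ 1`, below the convergence horizon `t₁ ≤ 0`** — again the hypothesis `hsym` of
`ZoomReturnDoorDssExtension.exists_dss_extension` (any `t₀ < t₁`). -/
theorem oneFactor_of_dss_limit {vn : ℕ → ℝ → EuclideanSpace ℝ (Fin 3) → EuclideanSpace ℝ (Fin 3)} {v : ℝ → EuclideanSpace ℝ (Fin 3) → EuclideanSpace ℝ (Fin 3)} {cn : ℕ → ℝ} {c t₁ : ℝ}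
    (ht₁ : t₁ ≤ 0) (hc : 1 ≤ c) (hcn : Tendsto cn atTop (𝓝 c))
    (hdss : ∀ n t x, vn n t x = cn n • vn n (cn n ^ 2 * t) (cn n • x))
    (hcc : ∀ t < t₁, ∀ (x : EuclideanSpace ℝ (Fin 3)) (tn : ℕ → ℝ) (xn : ℕ → EuclideanSpace ℝ (Fin 3)), Tendsto tn atTop (𝓝 t) →
      Tendsto xn atTop (𝓝 x) → Tendsto (fun n => vn n (tn n) (xn n)) atTop (𝓝 (v t x))) :
    ∀ t < t₁, ∀ x, v t x = c • v (c ^ 2 * t) (c • x) := by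
  intro t ht x
  have ht0 : t < 0 := lt_of_lt_of_le ht ht₁
  have hct : c ^ 2 * t < t₁ := by
    have h1 : 1 ≤ c ^ 2 := one_le_pow₀ hc
    nlinarith
  have hL : Tendsto (fun n => vn n t x) atTop (𝓝 (v t x)) :=
    hcc t ht x _ _ tendsto_const_nhds tendsto_const_nhds
  have hR : Tendsto (fun n => cn n • vn n (cn n ^ 2 * t) (cn n • x)) atTop (𝓝 (c • v (c ^ 2 * t) (c • x))) :=
    hcn.smul (hcc (c ^ 2 * t) hct (c • x) _ _ ((hcn.pow 2).mul_const t) (hcn.smul_const x))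
  exact tendsto_nhds_unique (hL.congr fun n => hdss n t x) hR

/-- **B1/G2 glue: equi-Lipschitz + pointwise convergence ⇒ CONTINUOUS CONVERGENCE** (the mode used above), for the
output of the tree's extraction `exists_strictMono_tendsto_of_lipschitzWith` (`∀ q, x (φ n) q → l q`, all `x n`
`K`-Lipschitz). -/
theorem continuousConvergence_of_lipschitzWith {X F : Type*} [PseudoMetricSpace X] [PseudoMetricSpace F] {K : ℝ≥0}
    {x : ℕ → X → F} {l : X → F} (hlip : ∀ n, LipschitzWith K (x n))
    (hptw : ∀ q, Tendsto (fun n => x n q) atTop (𝓝 (l q))) {q : X} {qn : ℕ → X}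
    (hq : Tendsto qn atTop (𝓝 q)) : Tendsto (fun n => x n (qn n)) atTop (𝓝 (l q)) := by
  rw [Metric.tendsto_atTop] at hq ⊢
  intro ε hε
  have hptw' := Metric.tendsto_atTop.1 (hptw q) (ε / 2) (half_pos hε)
  obtain ⟨N₁, hN₁⟩ := hptw'
  obtain ⟨N₂, hN₂⟩ := hq (ε / 2 / (K + 1)) (by positivity)
  refine ⟨max N₁ N₂, fun n hn => ?_⟩
  have h1 : dist (x n (qn n)) (x n q) ≤ K * dist (qn n) q := (hlip n).dist_le_mul _ _
  have h2 : dist (x n q) (l q) < ε / 2 := hN₁ n (le_of_max_le_left hn)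
  have h3 : dist (qn n) q < ε / 2 / (K + 1) := hN₂ n (le_of_max_le_right hn)
  have hK : (0 : ℝ) ≤ K := K.coe_nonneg
  have h4 : (K : ℝ) * dist (qn n) q ≤ (K + 1) * (ε / 2 / (K + 1)) := by
    have := mul_le_mul (show (K : ℝ) ≤ K + 1 by linarith) h3.le dist_nonneg (by positivity)
    exact this
  have h5 : ((K : ℝ) + 1) * (ε / 2 / (K + 1)) = ε / 2 := by field_simp
  calc dist (x n (qn n)) (l q) ≤ dist (x n (qn n)) (x n q) + dist (x n q) (l q) := dist_triangle _ _ _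
    _ < K * dist (qn n) q + ε / 2 := by linarith
    _ ≤ ε / 2 + ε / 2 := by linarith
    _ = ε := by ring

end Summit.NavierStokesRegularity.NavierStokesRegularity.Theorems.ZoomReturnDoorLimit
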